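import Summits.BirchSwinnertonDyer.BirchSwinnertonDyer.Theorems.Rank2ObservatoryRank3Psi3RationalRoots
import Literature.NumberTheory.EllipticCurves.TwoTorsionOddDegreeBaseChangeProofs
import HarnessLib

/-!
# Rank-2 observatory, rank-3 arm — THE MOD-2 GALOIS IMAGE OF THE RANK-3 TABLE, ROW BY ROW:
# `ρ̄_{E,2}` is onto `GL₂(𝔽₂)` on exactly `8 471` of the `9 487` rows; not onto on the `986` rows with a
# rational `2`-torsion point and on `30` further rows, where `E[2]` is irreducible and `Δ ∈ ℚ^{×2}`

HONEST FRAMING: per-curve certified theorems and census instruments; no claim on BSD in rank ≥ 2.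
Cell `b2b-bsdr2`, unit `b2b-bsdr2-cert-2` (rank-3 arm), gen 62 (KCI row 64); zero-kit; the only new data are the
`30` pairs `(i, √Δ)` of `c3Sqrt` (checked in the kernel against the row's `Δ`).
`--supports stmt-BirchSwinnertonDyer-16218 --as helper` (no stub closes; the value is a theorem).

WHAT IS CERTIFIED, for every row `r = rank3Table[i]` (the row's model `r.curve`, `Δ = r.delta`):
* `hasSurjectiveModNGaloisRep_two_iff_irreducible_and_not_isSquare` (generic, any elliptic `W/ℚ`):
  `ρ̄_{W,2}` onto `Aut(W[2]) ≅ GL₂(𝔽₂)` **iff** `W[2]` is an irreducible `Γ_ℚ`-module **and** `Δ_W ∉ ℚ^{×2}` — the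
  tree-PROVED Dokchitser–Dokchitser criterion (`DokchitserDokchitser2012.hasSurjectiveModNGaloisRep_two_iff_of_two_ne_zero`:
  onto iff no rational point of order `2` and `Δ ∉ ℚ^{×2}`) joined with the tree's "no point of order `2` iff the
  `2`-division cubic has no rational root" (`forall_two_nsmul_iff_forall_not_isRoot_twoTorsionPolynomial`) and
  "`E[2]` reducible iff the cubic has a rational root" (`not_hasIrreducibleModPGaloisRep_two_iff_exists_isRoot_…`).
* `Rank3Row.hasSurjectiveModNGaloisRep_two_iff_of_getElem?` — **hypothesis-free per row**:
  `ρ̄_{E_r,2}` onto **iff** `redTwoAt i = none` (row 58/60: no rational `2`-torsion, `E[2]` irreducible) **and**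
  `c3At i = none` (not one of the `30` listed square-`Δ` rows).  The three cases:
  `Rank3Row.hasSurjectiveModNGaloisRep_two_of_getElem?` (onto; `8 471` rows: `Δ ∉ ℚ^{×2}` certified by the least prime
  `ℓ ∈ {3, …, 47}` with `X² − Δ` rootless mod `ℓ`, searched IN THE KERNEL — row 63's `noRootModB` — then
  integral ⇒ rational by `Rat.isSquare_intCast_iff`), `Rank3Row.not_hasSurjectiveModNGaloisRep_two_of_redTwoAt`
  (`986` rows), `Rank3Row.irreducible_isSquare_of_c3At` (`30` rows: `E[2]` irreducible, `Δ = s²`, not onto — the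
  image is then the subgroup of order `3` of `GL₂(𝔽₂) ≅ S₃`, i.e. `ℚ(E[2])/ℚ` is cyclic cubic; only the three
  formal conjuncts are claimed).
* `surjectiveRows_count` / `c3Sqrt_offTwo`: `8 471` rows off both lists (kernel count over `range 9487`), the `30` listed rows
  off the `2`-torsion list; with row 58's `986`: `8 471 + 986 + 30 = 9 487`.  Samples `5077a1` (row `0`, onto) and
  `61504cg1` (row `189`, `Δ = 3968²`, not onto).
Method: one kernel pass `m2Go` per chunk (`decide +kernel`, row 59's indexed walk; structural soundness `m2Go_getElem?`,
assembly `m2Go_append`).  Sources: T. Dokchitser–V. Dokchitser, Math. Z. 272 (2012), Theorem (1); Silverman AEC III.1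
(`Δ`, `b`-invariants), III.2.3; Serre 1972 §5.3 (image of `ρ̄₂` in `S₃`, `Δ` square ⟺ image ⊂ `A₃`).
-/

set_option linter.dupNamespace false
set_option autoImplicit false

namespace Summit.BirchSwinnertonDyer.BirchSwinnertonDyer.Rank2Observatory

open Literature.NumberTheory.EllipticCurves WeierstrassCurve

/-! ## §1 The criterion: onto `GL₂(𝔽₂)` iff `E[2]` irreducible and `Δ ∉ ℚ^{×2}` -/

/-- **`ρ̄_{E,2}` onto ⟺ `E[2]` irreducible ∧ `Δ ∉ ℚ^{×2}`** for any elliptic curve over `ℚ` (any model):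
Dokchitser–Dokchitser (1) (tree-proved), with "no rational point of order `2`" ⟺ "the `2`-division cubic has no
rational root" ⟺ "`E[2]` irreducible" (tree theorems). [cite: DokchitserDokchitserMathZ2012, Theorem (1)]
[cite: SilvermanAEC2009, III.2.3] -/
theorem hasSurjectiveModNGaloisRep_two_iff_irreducible_and_not_isSquare (W : WeierstrassCurve ℚ)
    [W.IsElliptic] :
    W.HasSurjectiveModNGaloisRep 2 ↔ W.HasIrreducibleModPGaloisRep 2 ∧ ¬ IsSquare W.Δ := by
  haveI : PerfectField ℚ := PerfectField.ofCharZero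
  rw [DokchitserDokchitser2012.hasSurjectiveModNGaloisRep_two_iff_of_two_ne_zero W two_ne_zero,
    W.forall_two_nsmul_iff_forall_not_isRoot_twoTorsionPolynomial two_ne_zero, ← not_exists,
    ← W.not_hasIrreducibleModPGaloisRep_two_iff_exists_isRoot_twoTorsionPolynomial, not_not]

/-! ## §2 `Δ ∉ ℚ^{×2}` by a rootless prime, in the kernel -/

/-- `X ↦ X² − d`. [folklore] -/
def sqDefect (d : ℤ) : ℤ → ℤ := fun X => X * X - d

/-- `z − w ∣ (z² − d) − (w² − d)`. [folklore] -/
theorem sub_dvd_sqDefect (d z w : ℤ) : z - w ∣ sqDefect d z - sqDefect d w :=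
  ⟨z + w, by simp only [sqDefect]; ring⟩

/-- **`X² − d` rootless mod `ℓ` ⟹ `d ∉ ℚ^{×2}`**: a rational square root of an integer is an integer
(`Rat.isSquare_intCast_iff`), and an integer root survives reduction mod `ℓ` (row 63's `ne_zero_of_noRootModB`).
[folklore] -/
theorem not_isSquare_of_noRootModB_sqDefect {d : ℤ} {l : ℕ} (h : noRootModB (sqDefect d) l = true) :
    ¬ IsSquare (d : ℚ) := by
  rw [Rat.isSquare_intCast_iff]
  rintro ⟨z, hz⟩
  exact ne_zero_of_noRootModB (sub_dvd_sqDefect d) h z (by simp [sqDefect, hz])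

/-- the primes searched (the least rootless prime over the table is at most `47`). [folklore] -/
def sqPrimes : List ℕ := [3, 5, 7, 11, 13, 17, 19, 23, 29, 31, 37, 41, 43, 47]

/-- `d` is certified a non-square: `X² − d` is rootless modulo some listed prime (pure `ℤ` arithmetic — lighter in the
kernel on `24`-digit `Δ` than the rank-`2` arm's `ZMod`-based `nonSquareB`). [folklore] -/
def nonSqB (d : ℤ) : Bool := sqPrimes.any fun l => noRootModB (sqDefect d) l

/-- soundness of `nonSqB`. [folklore] -/
theorem not_isSquare_of_nonSqB {d : ℤ} (h : nonSqB d = true) : ¬ IsSquare (d : ℚ) := by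
  obtain ⟨l, -, hl⟩ := List.any_eq_true.mp h
  exact not_isSquare_of_noRootModB_sqDefect hl

/-! ## §3 Data: the `30` rows with `E[2]` irreducible and `Δ` a square, with `√Δ` -/

/-- `(i, s)`: row `i` has `E[2]` irreducible and `Δ = s²` (engine scope `mod2_scope.py`; checked below in the
kernel). Labels: `61504cg1, 106276b1, 117242a1, 118336bj1, 133956a1, 153458b1, 157609a1, 162712a1, 203796a1,
244412a1, 254016p1, 290222a1, 291924a1, 313348a1, 315218b1, 317720m1, 348140a1, 353648c1, 361816e1, 422968a1,
447458h1, 447458h2, 447636m1, 447636m2, 455544b1, 461041a1, 466088j1, 491172a1, 494312a1, 494312g1`. [folklore] -/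
def c3Sqrt : List (ℕ × ℕ) :=
  [(189, 3968), (636, 652), (804, 117242), (815, 2752), (975, 6588), (1266, 1108), (1327, 397),
   (1419, 7568), (2194, 611388), (2897, 244412), (3106, 84672), (3990, 290222), (4037, 97308),
   (4545, 2193436), (4598, 1588), (4650, 12220), (5313, 348140), (5427, 22816), (5623, 180908),
   (7270, 30212), (7951, 228932), (7952, 3662912), (7956, 55188), (7957, 300468), (8174, 480852),
   (8322, 4753), (8497, 33292), (9227, 8052), (9328, 35308), (9329, 247156)]

/-- the listed `√Δ` of row `i`, if any. [folklore] -/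
def c3At (i : ℕ) : Option ℕ := (c3Sqrt.find? fun p => p.1 == i).map Prod.snd

section counts
set_option maxHeartbeats 4000000
/-- the `30` listed rows are table indices off row 58's `2`-torsion list (so `E[2]` is irreducible there, row 60).
[folklore] -/
theorem c3Sqrt_offTwo : c3Sqrt.length = 30 ∧
    (c3Sqrt.all fun p => decide (p.1 < 9487) && (redTwoAt p.1).isNone) = true := by
  refine ⟨?_, ?_⟩ <;> decide +kernel
/-- **`8 471` rows are off both lists** (`+ 986` on the `2`-torsion list (row 58's `red_sizes`) `+ 30` square-`Δ`
rows `= 9 487`). [folklore] -/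
theorem surjectiveRows_count :
    ((List.range 9487).filter fun i => (redTwoAt i).isNone && (c3At i).isNone).length = 8471 := by
  decide +kernel
end counts

/-- a listed square-`Δ` row is off the `2`-torsion list. [folklore] -/
theorem redTwoAt_eq_none_of_c3At {i s : ℕ} (h : c3At i = some s) : redTwoAt i = none := by
  cases hf : c3Sqrt.find? (fun p => p.1 == i) with
  | none => simp [c3At, hf] at h
  | some p =>
    have hi : p.1 = i := by simpa using List.find?_some hf
    have hall := List.all_eq_true.mp c3Sqrt_offTwo.2 p (List.mem_of_find?_eq_some hf)
    simp only [Bool.and_eq_true, decide_eq_true_eq, Option.isNone_iff_eq_none, hi] at hall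
    exact hall.2

/-! ## §4 The row predicate and its one pass over the table -/

/-- row `r` at index `i` passes: on a listed square-`Δ` row, `s² = Δ`; otherwise a certified non-square `Δ` or (only then
consulted: the `20` reducible square-`Δ` rows) a listed `2`-torsion root. [folklore] -/
def Rank3Row.m2Check (r : Rank3Row) (i : ℕ) : Bool :=
  match c3At i with
  | some s => (s : ℤ) * s == r.delta
  | none => nonSqB r.delta || (redTwoAt i).isSome

/-- `m2Check` along a chunk whose first row has index `i`. [folklore] -/
def m2Go : List Rank3Row → ℕ → Bool
  | [], _ => true
  | r :: rs, i => r.m2Check i && m2Go rs (i + 1)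

/-- `m2Go` checks every row of the chunk at its index (structural). [folklore] -/
theorem m2Go_getElem? : ∀ (rows : List Rank3Row) (i j : ℕ) (r : Rank3Row),
    m2Go rows i = true → rows[j]? = some r → r.m2Check (i + j) = true := by
  intro rows
  induction rows with
  | nil => intro i j r _ h; simp at h
  | cons r₀ rs ih =>
    intro i j r hgo h
    simp only [m2Go, Bool.and_eq_true] at hgo
    cases j with
    | zero =>
      simp only [List.getElem?_cons_zero, Option.some.injEq] at h
      subst h; simpa using hgo.1
    | succ j =>
      simp only [List.getElem?_cons_succ] at h
      have := ih (i + 1) j r hgo.2 h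
      rwa [show i + 1 + j = i + (j + 1) by ring] at this

/-- `m2Go` splits along an append. [folklore] -/
theorem m2Go_append : ∀ (l₁ l₂ : List Rank3Row) (i : ℕ),
    m2Go (l₁ ++ l₂) i = (m2Go l₁ i && m2Go l₂ (i + l₁.length)) := by
  intro l₁
  induction l₁ with
  | nil => intro l₂ i; simp [m2Go]
  | cons r rs ih =>
    intro l₂ i
    simp only [List.cons_append, m2Go, ih, List.length_cons, Bool.and_assoc]
    congr 2
    rw [show i + 1 + rs.length = i + (rs.length + 1) by ring]

/-! ### One kernel pass per chunk (row 59's pattern; the non-square certificates are SEARCHED here, not listed) -/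
section chunks
set_option maxHeartbeats 4000000
/-- chunk `01` (rows `0 … 351`) passes. [folklore] -/ theorem m2c01 : m2Go rank3Rows01 0 = true := by decide +kernel
/-- chunk `02` (rows `352 … 703`) passes. [folklore] -/ theorem m2c02 : m2Go rank3Rows02 352 = true := by decide +kernel
/-- chunk `03` (rows `704 … 1055`) passes. [folklore] -/ theorem m2c03 : m2Go rank3Rows03 704 = true := by decide +kernel
/-- chunk `04` (rows `1056 … 1407`) passes. [folklore] -/ theorem m2c04 : m2Go rank3Rows04 1056 = true := by decide +kernel
/-- chunk `05` (rows `1408 … 1759`) passes. [folklore] -/ theorem m2c05 : m2Go rank3Rows05 1408 = true := by decide +kernel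
/-- chunk `06` (rows `1760 … 2111`) passes. [folklore] -/ theorem m2c06 : m2Go rank3Rows06 1760 = true := by decide +kernel
/-- chunk `07` (rows `2112 … 2463`) passes. [folklore] -/ theorem m2c07 : m2Go rank3Rows07 2112 = true := by decide +kernel
/-- chunk `08` (rows `2464 … 2815`) passes. [folklore] -/ theorem m2c08 : m2Go rank3Rows08 2464 = true := by decide +kernel
/-- chunk `09` (rows `2816 … 3167`) passes. [folklore] -/ theorem m2c09 : m2Go rank3Rows09 2816 = true := by decide +kernel
/-- chunk `10` (rows `3168 … 3519`) passes. [folklore] -/ theorem m2c10 : m2Go rank3Rows10 3168 = true := by decide +kernel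
/-- chunk `11` (rows `3520 … 3871`) passes. [folklore] -/ theorem m2c11 : m2Go rank3Rows11 3520 = true := by decide +kernel
/-- chunk `12` (rows `3872 … 4223`) passes. [folklore] -/ theorem m2c12 : m2Go rank3Rows12 3872 = true := by decide +kernel
/-- chunk `13` (rows `4224 … 4575`) passes. [folklore] -/ theorem m2c13 : m2Go rank3Rows13 4224 = true := by decide +kernel
/-- chunk `14` (rows `4576 … 4927`) passes. [folklore] -/ theorem m2c14 : m2Go rank3Rows14 4576 = true := by decide +kernel
/-- chunk `15` (rows `4928 … 5279`) passes. [folklore] -/ theorem m2c15 : m2Go rank3Rows15 4928 = true := by decide +kernel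
/-- chunk `16` (rows `5280 … 5631`) passes. [folklore] -/ theorem m2c16 : m2Go rank3Rows16 5280 = true := by decide +kernel
/-- chunk `17` (rows `5632 … 5983`) passes. [folklore] -/ theorem m2c17 : m2Go rank3Rows17 5632 = true := by decide +kernel
/-- chunk `18` (rows `5984 … 6335`) passes. [folklore] -/ theorem m2c18 : m2Go rank3Rows18 5984 = true := by decide +kernel
/-- chunk `19` (rows `6336 … 6687`) passes. [folklore] -/ theorem m2c19 : m2Go rank3Rows19 6336 = true := by decide +kernel
/-- chunk `20` (rows `6688 … 7039`) passes. [folklore] -/ theorem m2c20 : m2Go rank3Rows20 6688 = true := by decide +kernel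
/-- chunk `21` (rows `7040 … 7391`) passes. [folklore] -/ theorem m2c21 : m2Go rank3Rows21 7040 = true := by decide +kernel
/-- chunk `22` (rows `7392 … 7743`) passes. [folklore] -/ theorem m2c22 : m2Go rank3Rows22 7392 = true := by decide +kernel
/-- chunk `23` (rows `7744 … 8095`) passes. [folklore] -/ theorem m2c23 : m2Go rank3Rows23 7744 = true := by decide +kernel
/-- chunk `24` (rows `8096 … 8447`) passes. [folklore] -/ theorem m2c24 : m2Go rank3Rows24 8096 = true := by decide +kernel
/-- chunk `25` (rows `8448 … 8799`) passes. [folklore] -/ theorem m2c25 : m2Go rank3Rows25 8448 = true := by decide +kernel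
/-- chunk `26` (rows `8800 … 9151`) passes. [folklore] -/ theorem m2c26 : m2Go rank3Rows26 8800 = true := by decide +kernel
/-- chunk `27` (rows `9152 … 9486`) passes. [folklore] -/ theorem m2c27 : m2Go rank3Rows27 9152 = true := by decide +kernel
end chunks

/-- **the whole table passes** (the `27` chunk passes assembled along `m2Go_append`, chunk lengths from row 60).
[folklore] -/
theorem m2Go_rank3Table : m2Go rank3Table 0 = true := by
  simp only [rank3Table, m2Go_append, List.length_append, Nat.reduceAdd, Bool.and_self,
    rank3Rows01_length, rank3Rows02_length, rank3Rows03_length, rank3Rows04_length, rank3Rows05_length,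
    rank3Rows06_length, rank3Rows07_length, rank3Rows08_length, rank3Rows09_length, rank3Rows10_length,
    rank3Rows11_length, rank3Rows12_length, rank3Rows13_length, rank3Rows14_length, rank3Rows15_length,
    rank3Rows16_length, rank3Rows17_length, rank3Rows18_length, rank3Rows19_length, rank3Rows20_length,
    rank3Rows21_length, rank3Rows22_length, rank3Rows23_length, rank3Rows24_length, rank3Rows25_length,
    rank3Rows26_length,
    m2c01, m2c02, m2c03, m2c04, m2c05, m2c06, m2c07, m2c08, m2c09, m2c10, m2c11, m2c12, m2c13, m2c14, m2c15,
    m2c16, m2c17, m2c18, m2c19, m2c20, m2c21, m2c22, m2c23, m2c24, m2c25, m2c26, m2c27]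

/-- every row passes `m2Check` at its index. [folklore] -/
theorem Rank3Row.m2Check_of_getElem? {i : ℕ} {r : Rank3Row} (h : rank3Table[i]? = some r) :
    r.m2Check i = true := by
  simpa using m2Go_getElem? rank3Table 0 i r m2Go_rank3Table h

/-! ## §5 The three cases, row by row -/

/-- **not onto on the `986` rows with a rational `2`-torsion point** (`E[2]` reducible, row 60).
[cite: DokchitserDokchitserMathZ2012, Theorem (1)] -/
theorem Rank3Row.not_hasSurjectiveModNGaloisRep_two_of_redTwoAt {i : ℕ} {r : Rank3Row}
    (h : rank3Table[i]? = some r) {X : ℤ} (hX : redTwoAt i = some X) :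
    ¬ r.curve.HasSurjectiveModNGaloisRep 2 := by
  haveI := isElliptic_of_mem (List.mem_of_getElem? h)
  rw [hasSurjectiveModNGaloisRep_two_iff_irreducible_and_not_isSquare]
  exact fun hs => Rank3Row.not_hasIrreducibleModPGaloisRep_two_of_getElem? h hX hs.1

/-- a listed square-`Δ` row has no listed `2`-torsion root and `Δ = s²`. [cite: SilvermanAEC2009, III.1] -/
theorem Rank3Row.of_c3At {i : ℕ} {r : Rank3Row} (h : rank3Table[i]? = some r) {s : ℕ}
    (hs : c3At i = some s) : redTwoAt i = none ∧ r.curve.Δ = (s : ℚ) ^ 2 := by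
  have hc := Rank3Row.m2Check_of_getElem? h
  simp only [Rank3Row.m2Check, hs, beq_iff_eq] at hc
  refine ⟨redTwoAt_eq_none_of_c3At hs, ?_⟩
  rw [Rank3Row.curve_Δ, ← hc]
  push_cast
  ring

/-- **the `30` square-`Δ` rows: `E[2]` irreducible, `Δ ∈ ℚ^{×2}`, `ρ̄_{E,2}` NOT onto** (its image is then the
subgroup of order `3` of `GL₂(𝔽₂) ≅ S₃` — informal; the three conjuncts are what is certified).
[cite: DokchitserDokchitserMathZ2012, Theorem (1)] [cite: Serre1972] -/
theorem Rank3Row.irreducible_isSquare_of_c3At {i : ℕ} {r : Rank3Row} (h : rank3Table[i]? = some r)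
    {s : ℕ} (hs : c3At i = some s) :
    r.curve.HasIrreducibleModPGaloisRep 2 ∧ IsSquare r.curve.Δ ∧ ¬ r.curve.HasSurjectiveModNGaloisRep 2 := by
  haveI := isElliptic_of_mem (List.mem_of_getElem? h)
  obtain ⟨hX, hΔ⟩ := Rank3Row.of_c3At h hs
  have hsq : IsSquare r.curve.Δ := ⟨s, by rw [hΔ, sq]⟩
  exact ⟨Rank3Row.hasIrreducibleModPGaloisRep_two_of_getElem? h hX, hsq, fun hsur =>
    ((hasSurjectiveModNGaloisRep_two_iff_irreducible_and_not_isSquare r.curve).mp hsur).2 hsq⟩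

/-- **onto `GL₂(𝔽₂)` on the `8 471` remaining rows**: `E[2]` irreducible (row 60) and `Δ ∉ ℚ^{×2}` (kernel
rootless prime). [cite: DokchitserDokchitserMathZ2012, Theorem (1)] -/
theorem Rank3Row.hasSurjectiveModNGaloisRep_two_of_getElem? {i : ℕ} {r : Rank3Row}
    (h : rank3Table[i]? = some r) (hX : redTwoAt i = none) (hc : c3At i = none) :
    r.curve.HasSurjectiveModNGaloisRep 2 := by
  haveI := isElliptic_of_mem (List.mem_of_getElem? h)
  have hm := Rank3Row.m2Check_of_getElem? h
  simp only [Rank3Row.m2Check, hc, hX, Option.isSome_none, Bool.or_false] at hm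
  rw [hasSurjectiveModNGaloisRep_two_iff_irreducible_and_not_isSquare, Rank3Row.curve_Δ]
  exact ⟨Rank3Row.hasIrreducibleModPGaloisRep_two_of_getElem? h hX, not_isSquare_of_nonSqB hm⟩

/-- **THE MOD-2 IMAGE OF EVERY ROW, hypothesis-free**: `ρ̄_{E_r,2}` is onto `GL₂(𝔽₂)` iff row `i` is off row 58's
`2`-torsion list and off `c3Sqrt`. [cite: DokchitserDokchitserMathZ2012, Theorem (1)] -/
theorem Rank3Row.hasSurjectiveModNGaloisRep_two_iff_of_getElem? {i : ℕ} {r : Rank3Row}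
    (h : rank3Table[i]? = some r) :
    r.curve.HasSurjectiveModNGaloisRep 2 ↔ redTwoAt i = none ∧ c3At i = none := by
  refine ⟨fun hs => ⟨?_, ?_⟩,
    fun hh => Rank3Row.hasSurjectiveModNGaloisRep_two_of_getElem? h hh.1 hh.2⟩
  · cases hX : redTwoAt i with
    | none => rfl
    | some X => exact absurd hs (Rank3Row.not_hasSurjectiveModNGaloisRep_two_of_redTwoAt h hX)
  · cases hc : c3At i with
    | none => rfl
    | some s => exact absurd hs (Rank3Row.irreducible_isSquare_of_c3At h hc).2.2

/-! ## §6 Samples -/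

/-- **`5077a1`** (row `0`, the rank-`3` curve of least conductor): `ρ̄_{E,2}` onto `GL₂(𝔽₂)`.
[cite: DokchitserDokchitserMathZ2012, Theorem (1)] -/
theorem hasSurjectiveModNGaloisRep_two_5077a1 {r : Rank3Row} (h : rank3Table[0]? = some r) :
    r.curve.HasSurjectiveModNGaloisRep 2 :=
  Rank3Row.hasSurjectiveModNGaloisRep_two_of_getElem? h (by decide +kernel) (by decide +kernel)

/-- **`61504cg1`** (row `189`): `E[2]` irreducible, `Δ = 3968²`, `ρ̄_{E,2}` not onto.
[cite: DokchitserDokchitserMathZ2012, Theorem (1)] -/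
theorem not_hasSurjectiveModNGaloisRep_two_61504cg1 {r : Rank3Row} (h : rank3Table[189]? = some r) :
    r.curve.HasIrreducibleModPGaloisRep 2 ∧ r.curve.Δ = (3968 : ℚ) ^ 2 ∧
      ¬ r.curve.HasSurjectiveModNGaloisRep 2 := by
  have hc : c3At 189 = some 3968 := by decide +kernel
  obtain ⟨h1, -, h3⟩ := Rank3Row.irreducible_isSquare_of_c3At h hc
  exact ⟨h1, by exact_mod_cast (Rank3Row.of_c3At h hc).2, h3⟩

end Summit.BirchSwinnertonDyer.BirchSwinnertonDyer.Rank2Observatory
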